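import Summits.AtomisticToContinuum.Crystallization.Theorems.LayeredLawsSelectHcp.Negative.Threshold

/-!
# Negative knowledge for crux `LayeredLawsSelectHcp` (stmt-AtomisticToContinuum-9226), XVII:
# threshold sensitivity — the crux with `e*` replaced by a number `t`

Part XVII (`--supports stmt-AtomisticToContinuum-9226`; gen 2 / cycle 2 of the standing disprover). H3 compares
`E_P[h]` with the UNKNOWN real `e* = ⨅ e(Q)`. Replacing `e*` by an explicit threshold `t` gives the family
`WithThreshold t` (antitone in `t`; `LayeredLawsSelectHcp ↔ WithThreshold e*` definitionally,
`crux_iff_withThreshold`). **`withThreshold_false_of_fcc_le`**: false at every `t ≥ e(fccPC a)`, `a ∈ [9/10, 1]`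
(the fcc Palm law of part IV passes the weakened H3 and is not hcp); **`withThreshold_neg_half_false`** (certified,
part XV) and `withThreshold_false_of_neg_half_le`; and **`eStar_lt_fcc_of_crux`**: `crux ⇒ e* < e(fccPC a)` for every
admissible `a` — a proof of the crux contains a proof that fcc is not a periodic Lennard-Jones minimiser at any
scale in `[9/10, 1]`. Numerically the statement is decided inside the window `[e*, inf_a e(fccPC a))` of width
`e_fcc,min − e_hcp,min ≈ 7.25·10⁻⁵ ≈ 1.0·10⁻⁴|e*|` (kit j012726; interval arithmetic in kit j013916). All `[folklore]`.
-/

noncomputable section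

namespace Summit.AtomisticToContinuum.Crystallization.Theorems.LayeredLawsSelectHcp.Negative.ThresholdSensitivity

open MeasureTheory Set
open Literature.MathematicalPhysics.StatisticalMechanics Literature.Geometry.DiscreteGeometry
open Summit.AtomisticToContinuum.Crystallization.Theses.PalmUnimodularRigidity (LayeredLawsSelectHcp)
open Summit.AtomisticToContinuum.Crystallization.Theorems.ChargedEnergyGapNegative
  (eStar eStar_le bddBelow_energyPerParticle_lennardJones)
open Summit.AtomisticToContinuum.Crystallization.Theorems.LayeredLawsSelectHcp.Negative.DiracLaws
open Summit.AtomisticToContinuum.Crystallization.Theorems.LayeredLawsSelectHcp.Negative.IntegerForms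
open Summit.AtomisticToContinuum.Crystallization.Theorems.LayeredLawsSelectHcp.Negative.FccLattice
open Summit.AtomisticToContinuum.Crystallization.Theorems.LayeredLawsSelectHcp.Negative.FccModel
open Summit.AtomisticToContinuum.Crystallization.Theorems.LayeredLawsSelectHcp.Negative.FccEnergy
open Summit.AtomisticToContinuum.Crystallization.Theorems.LayeredLawsSelectHcp.Negative.Threshold

/-- Euclidean `3`-space. [folklore] -/
local notation "E3" => EuclideanSpace ℝ (Fin 3)

/-! ## Threshold sensitivity: the crux with `e*` replaced by a number `t` -/

section ThresholdSensitivity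

/-- The crux with the minimising threshold `e*` replaced by the real number `t`. [folklore] -/
def WithThreshold (t : ℝ) : Prop :=
  ∀ δ : ℝ, 0 < δ → ∀ P : Measure (Measure E3), IsProbabilityMeasure P →
    Rooted δ P → PointStationary P → meanRootEnergy P ≤ t → Layered P → ∀ᵐ μ ∂P, IsRelaxedHcp μ

/-- `LayeredLawsSelectHcp` is the member `t = e*` of the family (definitional). [folklore] -/
theorem crux_iff_withThreshold : LayeredLawsSelectHcp ↔ WithThreshold eStar := crux_iff

/-- The family is antitone in the threshold: a larger `t` admits more laws. [folklore] -/
theorem WithThreshold.anti {t t' : ℝ} (h : t' ≤ t) (H : WithThreshold t) : WithThreshold t' :=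
  fun δ hδ P hP h1 h2 h3 h4 => H δ hδ P hP h1 h2 (h3.trans h) h4

/-- **False at every threshold at or above an admissible fcc energy**: if `e(fccPC a) ≤ t` for some
`a ∈ [9/10, 1]`, the fcc Palm law `fccLaw a` satisfies H1, H2, H4 and the weakened H3, and is not a
rotated relaxed hcp. [folklore] -/
theorem withThreshold_false_of_fcc_le {a t : ℝ} (h9 : 9 / 10 ≤ a) (h1 : a ≤ 1)
    (ht : (fccPC (show a ≠ 0 by intro h; rw [h] at h9; norm_num at h9)).energyPerParticle lennardJones ≤ t) :
    ¬ WithThreshold t := fun H =>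
  not_ae_isRelaxedHcp_fccLaw a (H a (by linarith) (fccLaw a) inferInstance
    (rooted_fccLaw (by linarith) le_rfl) (pointStationary_fccLaw a)
    (by rw [meanRootEnergy_fccLaw_eq_energyPerParticle]; exact ht) (layered_fccLaw h9 h1))

/-- **In particular the statement with threshold `−1/2` is false** (certified: `e(fccPC 1) ≤ −1/2`,
§19), although `e* ≤ −1/2`: the weakening of H3 from `≤ e*` to `≤ −1/2` already admits fcc.
[folklore] -/
theorem withThreshold_neg_half_false : ¬ WithThreshold (-1 / 2) :=
  withThreshold_false_of_fcc_le (a := 1) (by norm_num) le_rfl energyPerParticle_fccPC_one_le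

/-- Hence false at every `t ≥ −1/2` (e.g. `t = 0`, the junk value of a non-integrable mean root
energy). [folklore] -/
theorem withThreshold_false_of_neg_half_le {t : ℝ} (ht : -1 / 2 ≤ t) : ¬ WithThreshold t :=
  fun H => withThreshold_neg_half_false (H.anti ht)

/-- **The crux decides fcc-vs-the-rest**: `LayeredLawsSelectHcp ⇒ e* < e(fccPC a)` for every
`a ∈ [9/10, 1]` — strict inequality, i.e. fcc at no admissible scale is a periodic Lennard-Jones
minimiser. (Unconditionally only `e* ≤ e(fccPC a)` is known, `eStar_le_energyPerParticle_fccPC`;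
the printed gap is `+7.25·10⁻⁵`.) [folklore] -/
theorem eStar_lt_fcc_of_crux (H : LayeredLawsSelectHcp) {a : ℝ} (h9 : 9 / 10 ≤ a) (h1 : a ≤ 1) :
    eStar < (fccPC (show a ≠ 0 by intro h; rw [h] at h9; norm_num at h9)).energyPerParticle lennardJones := by
  by_contra hle
  exact withThreshold_false_of_fcc_le h9 h1 (not_lt.1 hle) (crux_iff_withThreshold.1 H)

/-- The set of thresholds at which the statement holds is a down-set of `ℝ` disjoint from
`[e(fccPC a), ∞)` for every admissible `a`; the crux holds iff `e*` belongs to it. [folklore] -/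
theorem withThreshold_true_set_subset {t : ℝ} (H : WithThreshold t) {a : ℝ} (h9 : 9 / 10 ≤ a)
    (h1 : a ≤ 1) :
    t < (fccPC (show a ≠ 0 by intro h; rw [h] at h9; norm_num at h9)).energyPerParticle lennardJones := by
  by_contra hle
  exact withThreshold_false_of_fcc_le h9 h1 (not_lt.1 hle) H

end ThresholdSensitivity

end Summit.AtomisticToContinuum.Crystallization.Theorems.LayeredLawsSelectHcp.Negative.ThresholdSensitivity

end
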